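import Summits.QuantumFields.YangMills.Theorems.LuscherReductionTwistedTraceScalingShellAssembly
import Summits.QuantumFields.YangMills.Theorems.LuscherReductionTwistedTraceScalingWindowDefs
import HarnessLib

/-!
# R1 — THE SHELL ASSEMBLY WITH LOG RATE: `InnerShellGainSmallLogAt` ⟸ `ShellBricks` + the LOG-RATE domination `hdomLog`
# (lane A of S-BASE, crux `TwistedTraceScaling` stmt-QuantumFields-20203, line «twolattice», stub `stub_fixedLatticeTraceLaw`; hand A for lead g24; card `Lines-window-floor.md` §3 R1)

W(L) counts levels up to femto energy `c₁ log β` at ONE threshold `β₀`, so the thin-shell gains must be exported WITH A RATE `e^{−(c·log β)·λ_b(L³β)}` (✓`InnerShellGainSmallLogAt`,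
lead W1 ✓`…WindowDefs`) instead of the `∀ A, ∃ β₀` text of ✓`InnerShellGainSmallAt` (cdisprove R72 (5)).  The MECHANISM of ✓`…ShellAssembly` has the rate; this file re-exports it:
* `log_mul_bareLambda_le_powScale` — `M·log β·λ_b(L³β) ≤ β^{−p}` eventually (`p < 1/3`, every `M`); `log_mul_bareLambda_le_of_pos` — hence `≤ ε` eventually;
* `shellDom_of_logDom` — the log-rate domination `∀ c, ∀ᶠ β, (c log β)λ_b + 6κ + 2b²/θ₀ ≤ t√t/80 ∧ (c log β)λ_b ≤ θ₀/2` implies the constant-rate field `ShellBricks.hdom`;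
* ★★★ `softTubeGainRate_of_shellBricks` — the SUP bound on the soft tube with an ARBITRARY rate function `R`: if eventually `(|R β| + 1)λ_b + 6κ + 2b²/θ₀ ≤ t√t/80 ∧ (|R β| + 1)λ_b ≤ θ₀/2`,
  then eventually `T(f) ≤ e^{−R(β)·λ_b(L³β)}·λ₀·‖f‖²_{N/χ}` on `supp χ ∩ {orbitDist < δ} ∩ {δc/2 < orbitDist}` (✓`shell_gain_fixed`; endgame `σμ₀(1 − m) ≤ e^{λ_b}λ₀e^{−(|R|+1)λ_b} ≤ e^{−Rλ_b}λ₀`);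
* ★★★ `softTubeGainLog_of_shellBricks (K) (hdomLog) (c)` — the log rate `R β = c·log β`; ★★★ `shellGainOneOrbitLogAt_of_shellBricks` (slice reduction, every `η`);
* ★★ `innerShellGainSmallLogAt_of_oneOrbit` / `…_pow_of_oneOrbit` — the eight-copies step with log rate (`crossBound_le_gain_log`);
* ★★★ `innerShellGainSmallLogAt_of_shellBricks (hb : 0 < b) (K : ShellBricks L χ (β^{−a}) (β^{−b})) (hdomLog) : InnerShellGainSmallLogAt L (β^{−a}) (β^{−b}) (β^{−q})`.
HONEST FRAMING: the assembly is PROVED (a re-export of landed mechanisms with their rate); its record instances (R2), the log-rate valley chain (R3–R5), W(L), `stub_cmpTwoLoop`,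
`stub_labelTracking` and the crux `TwistedTraceScaling` are OPEN; CONDITIONAL route R2b1; fixed lattice size, eventually in `β`; not infinite volume, not a mass gap, not Clay.  No `sorry`.
-/

set_option autoImplicit false

noncomputable section

open MeasureTheory Filter Topology Real
open scoped BigOperators
open Literature.MathematicalPhysics.QuantumFieldTheory
open Literature.MathematicalPhysics.QuantumLattice

namespace Summit.QuantumFields.YangMills.Theorems.FemtoTransferGap.TwoLattice.ConstTube

open Summit.QuantumFields.YangMills.Theorems.FemtoTransferGap
open Summit.QuantumFields.YangMills.Theorems.FemtoTransferGap.TwoLattice.Avg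
open Summit.QuantumFields.YangMills.Theorems.FemtoTransferGap.TwoLattice.Stiff (LinkSpace)

variable {L : ℕ} [NeZero L]

/-! ## §1 Log rates against `λ_b(L³β) ≍ β^{−1/3}` -/

/-- **Log rates are dominated by every power below `1/3`**: for `p < 1/3` and every `M`, eventually `M·log β·λ_b(L³β) ≤ β^{−p}` (`λ_b(L³β) = (2/L³)^{1/3}β^{−1/3}`,
`log β = o(β^{1/3−p})`). [folklore] -/
theorem log_mul_bareLambda_le_powScale {p : ℝ} (hp : p < 1 / 3) (M : ℝ) :
    ∀ᶠ β : ℝ in atTop, M * Real.log β * bareLambda ((L : ℝ) ^ 3 * β) ≤ powScale p β := by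
  have hL : (0 : ℝ) < (L : ℝ) ^ 3 := by
    have : (0 : ℝ) < L := by exact_mod_cast Nat.pos_of_ne_zero (NeZero.ne L)
    positivity
  by_cases hM : M ≤ 0
  · filter_upwards [Filter.eventually_ge_atTop (1 : ℝ)] with β hβ1
    have hβ0 : 0 < β := by linarith
    have h1 : 0 < bareLambda ((L : ℝ) ^ 3 * β) := bareLambda_pos' (by positivity)
    have h2 := powScale_pos p β
    have h3 : 0 ≤ Real.log β := Real.log_nonneg hβ1
    have h4 : M * Real.log β ≤ 0 := by nlinarith
    nlinarith
  · push Not at hM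
    set K : ℝ := M * (2 / (L : ℝ) ^ 3) ^ ((1 : ℝ) / 3) with hK
    have hK0 : 0 < K := by rw [hK]; positivity
    have hr : 0 < 1 / 3 - p := by linarith
    have ho := (isLittleO_log_rpow_atTop hr).bound (show (0 : ℝ) < 1 / K by positivity)
    filter_upwards [ho, Filter.eventually_ge_atTop (1 : ℝ)] with β hβ hβ1
    have hβ0 : 0 < β := by linarith
    rw [Real.norm_of_nonneg (Real.log_nonneg hβ1), Real.norm_of_nonneg (Real.rpow_nonneg hβ0.le _)] at hβ
    rw [bareLambda_cube_eq (L := L) hβ0, powScale_eq hβ1]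
    have hsplit : β ^ (-p) = β ^ (1 / 3 - p) * β ^ (-(1 : ℝ) / 3) := by
      rw [← Real.rpow_add hβ0]; congr 1; ring
    rw [hsplit]
    have hb3 : 0 < β ^ (-(1 : ℝ) / 3) := Real.rpow_pos_of_pos hβ0 _
    calc M * Real.log β * ((2 / (L : ℝ) ^ 3) ^ ((1 : ℝ) / 3) * β ^ (-(1 : ℝ) / 3))
        = K * Real.log β * β ^ (-(1 : ℝ) / 3) := by rw [hK]; ring
      _ ≤ K * (1 / K * β ^ (1 / 3 - p)) * β ^ (-(1 : ℝ) / 3) :=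
          mul_le_mul_of_nonneg_right (mul_le_mul_of_nonneg_left hβ hK0.le) hb3.le
      _ = β ^ (1 / 3 - p) * β ^ (-(1 : ℝ) / 3) := by field_simp

/-- Hence `M·log β·λ_b(L³β) ≤ ε` eventually, for every `ε > 0`. [folklore] -/
theorem log_mul_bareLambda_le_of_pos (M : ℝ) {ε : ℝ} (hε : 0 < ε) :
    ∀ᶠ β : ℝ in atTop, M * Real.log β * bareLambda ((L : ℝ) ^ 3 * β) ≤ ε := by
  filter_upwards [log_mul_bareLambda_le_powScale (L := L) (p := 0) (by norm_num) (M / ε)] with β hβ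
  have h1 : powScale 0 β ≤ 1 := powScale_le_one le_rfl β
  have h2 : M / ε * Real.log β * bareLambda ((L : ℝ) ^ 3 * β) ≤ 1 := hβ.trans h1
  have e : M * Real.log β * bareLambda ((L : ℝ) ^ 3 * β) = ε * (M / ε * Real.log β * bareLambda ((L : ℝ) ^ 3 * β)) := by
    field_simp
  rw [e]
  nlinarith

/-- `|c·log β|·λ + λ ≤ (|c| + 1)·log β·λ` once `log β ≥ 1` (`λ ≥ 0`). [folklore] -/
theorem log_rate_abs_le {c β lam : ℝ} (hβ : Real.exp 1 ≤ β) (hlam : 0 ≤ lam) :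
    (|c * Real.log β| + 1) * lam ≤ (|c| + 1) * Real.log β * lam := by
  have hβ0 : 0 < β := lt_of_lt_of_le (Real.exp_pos 1) hβ
  have hlog1 : 1 ≤ Real.log β := by
    have := Real.log_le_log (Real.exp_pos 1) hβ
    rwa [Real.log_exp] at this
  have hlog0 : 0 ≤ Real.log β := by linarith
  rw [abs_mul, abs_of_nonneg hlog0]
  have h1 : |c| * Real.log β + 1 ≤ (|c| + 1) * Real.log β := by nlinarith [abs_nonneg c]
  have := mul_le_mul_of_nonneg_right h1 hlam
  linarith

/-- **Log domination implies constant domination**: the log-rate form of the shell domination clause implies the field `ShellBricks.hdom` (`A·λ_b ≤ (1·log β)·λ_b` for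
`β ≥ e^{A}`), so a record instance proves the log form only. [folklore] -/
theorem shellDom_of_logDom {κ b t : ℝ → ℝ} {θ₀ : ℝ}
    (hlog : ∀ c : ℝ, ∀ᶠ β : ℝ in atTop, c * Real.log β * bareLambda ((L : ℝ) ^ 3 * β) + 6 * κ β + 2 * b β ^ 2 / θ₀ ≤ t β * Real.sqrt (t β) / 80 ∧
      c * Real.log β * bareLambda ((L : ℝ) ^ 3 * β) ≤ θ₀ / 2) (A : ℝ) :
    ∀ᶠ β : ℝ in atTop, A * bareLambda ((L : ℝ) ^ 3 * β) + 6 * κ β + 2 * b β ^ 2 / θ₀ ≤ t β * Real.sqrt (t β) / 80 ∧ A * bareLambda ((L : ℝ) ^ 3 * β) ≤ θ₀ / 2 := by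
  have hL1 : (1 : ℝ) ≤ (L : ℝ) ^ 3 := one_le_pow₀ (by exact_mod_cast NeZero.one_le)
  filter_upwards [hlog 1, Filter.eventually_ge_atTop (max 1 (Real.exp A))] with β hβ hβA
  have hβ1 : 1 ≤ β := (le_max_left _ _).trans hβA
  have hβ0 : 0 < β := by linarith
  have hlam0 : 0 < bareLambda ((L : ℝ) ^ 3 * β) := bareLambda_pos' (by nlinarith)
  have hA : A ≤ Real.log β := by
    have := Real.log_le_log (Real.exp_pos A) ((le_max_right _ _).trans hβA)
    rwa [Real.log_exp] at this
  have h1 : A * bareLambda ((L : ℝ) ^ 3 * β) ≤ 1 * Real.log β * bareLambda ((L : ℝ) ^ 3 * β) := by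
    rw [one_mul]; exact mul_le_mul_of_nonneg_right hA hlam0.le
  exact ⟨by linarith [hβ.1], h1.trans hβ.2⟩

/-! ## §2 The SUP bound on the soft tube with an arbitrary rate -/

set_option maxHeartbeats 400000 in
/-- ★★★ **THE SUP BOUND ON THE SOFT TUBE WITH A RATE FUNCTION**: from `ShellBricks L χ δc δ` and the domination of `(|R β| + 1)·λ_b` (in place of a constant multiple),
eventually in `β`, every bounded measurable `f` supported in `supp χ ∩ {orbitDist < δ} ∩ {δc/2 < orbitDist}` has `T(f) ≤ e^{−R(β)·λ_b(L³β)}·λ₀(β,L)·‖f‖²_{N/χ}`.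
The proof is that of ✓`softTubeGain_of_shellBricks` with the rate carried through the endgame. [cite: Luscher1983, §3] [cite: SjostrandZworski2007, §2] -/
theorem softTubeGainRate_of_shellBricks {χ : ℝ → GaugeConfig 3 L SU2 → ℝ} {δc δ : ℝ → ℝ} (K : ShellBricks L χ δc δ) (R : ℝ → ℝ)
    (hdomR : ∀ᶠ β : ℝ in atTop, (|R β| + 1) * bareLambda ((L : ℝ) ^ 3 * β) + 6 * K.κ β + 2 * K.b β ^ 2 / K.θ₀ ≤ K.t β * Real.sqrt (K.t β) / 80 ∧
      (|R β| + 1) * bareLambda ((L : ℝ) ^ 3 * β) ≤ K.θ₀ / 2) :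
    ∀ᶠ β : ℝ in atTop, ∀ f : GaugeConfig 3 L SU2 → ℝ, Measurable f → (∃ C : ℝ, ∀ U, |f U| ≤ C) →
      (∀ U, f U ≠ 0 → χ β U ≠ 0 ∧ orbitDist U < δ β ∧ δc β / 2 < orbitDist U) →
        tubeForm β f ≤ Real.exp (-(R β * bareLambda ((L : ℝ) ^ 3 * β))) * levelValue su2Rep L β 0 * tubeNormSq (softWeight (χ β)) f := by
  have hL1 : (1 : ℝ) ≤ (L : ℝ) ^ 3 := one_le_pow₀ (by exact_mod_cast NeZero.one_le)
  obtain ⟨hθ0, hθ1⟩ := K.hθ₀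
  obtain ⟨B₀, hann⟩ := oneSite_annulus_gain_orbitDist
  filter_upwards [Filter.eventually_ge_atTop (max 1 B₀), K.hδ₁, K.hshadow, K.hshadowIn, K.hbo, K.ht, K.hfloor, hdomR, K.hN, K.hT, K.hST, K.hOD]
    with β hβ hδ₁ hshadow hshadowIn hbo ht hfloor hdom hN hT hST hOD
  intro f hfm hfb hfs
  have hβ1 : 1 ≤ β := (le_max_left _ _).trans hβ
  have hβ0 : 0 < β := by linarith only [hβ1]
  have hβB₀ : B₀ ≤ β := (le_max_right _ _).trans hβ
  have hBβ : β ≤ (L : ℝ) ^ 3 * β := by nlinarith only [hL1, hβ0]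
  have hB0 : 0 < ((L : ℝ) ^ 3 * β) := lt_of_lt_of_le hβ0 hBβ
  have hlam0 : 0 < bareLambda ((L : ℝ) ^ 3 * β) := bareLambda_pos' hB0
  have hμ0 : 0 < levelValue su2Rep 1 ((L : ℝ) ^ 3 * β) 0 := levelValue_su2Rep_pos (L := 1) hB0 0
  have hΛ0 : 0 < levelValue su2Rep L β 0 := levelValue_su2Rep_pos hβ0 0
  obtain ⟨Cw, hCw⟩ := K.hwb β
  obtain ⟨Cf, hCf⟩ := hfb
  obtain ⟨ht1, ht2⟩ := ht
  have ht0 : 0 < K.t β := lt_of_lt_of_le (Real.rpow_pos_of_pos hB0 _) ht1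
  set g : ℝ := K.t β * Real.sqrt (K.t β) / 80 with hgdef
  have hst1 : Real.sqrt (K.t β) ≤ 1 := Real.sqrt_le_one.mpr (by linarith only [ht2])
  have hg0 : 0 ≤ g := by rw [hgdef]; positivity
  have hg1 : g ≤ 1 := by
    rw [hgdef]
    have : K.t β * Real.sqrt (K.t β) ≤ 1 / 5000 * 1 := mul_le_mul ht2 hst1 (Real.sqrt_nonneg _) (by norm_num)
    linarith only [this]
  obtain ⟨hdom1, hdom2⟩ := hdom
  set A' : ℝ := |R β| + 1 with hA'
  have hA'0 : 0 < A' := by rw [hA']; positivity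
  have hA'lam : 0 ≤ A' * bareLambda ((L : ℝ) ^ 3 * β) := by positivity
  have hb2 : 0 ≤ 2 * K.b β ^ 2 / K.θ₀ := by positivity
  have hκ0 := K.hκ β
  have hκhalf : K.κ β ≤ 1 / 2 := by
    have : 6 * K.κ β ≤ g := by linarith only [hdom1, hA'lam, hb2]
    linarith only [this, hg1]
  have hAG : ∀ G : GaugeConfig 3 1 SU2 → ℝ, Measurable G → (∃ C : ℝ, ∀ u, |G u| ≤ C) →
      (∀ (g' : Site 3 1 → SU2) (u : GaugeConfig 3 1 SU2), G (gaugeTransform g' u) = G u) → (∀ u, G u ≠ 0 → 6 * K.t β ≤ orbitDist u ∧ orbitDist u < 2) →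
      qform su2Rep ((L : ℝ) ^ 3 * β) G G ≤ (1 - g) * levelValue su2Rep 1 ((L : ℝ) ^ 3 * β) 0 * l2 G G := fun G hGm hGb _ hGs =>
    hann ((L : ℝ) ^ 3 * β) (hβB₀.trans hBβ) (K.t β) ht1 ht2 G hGm hGb hGs
  have hTup : ∀ φ : GaugeConfig 3 1 SU2 → ℝ, Measurable φ → (∃ C : ℝ, ∀ u, |φ u| ≤ C) →
      (∀ (g : Site 3 1 → SU2) (u : GaugeConfig 3 1 SU2), φ (gaugeTransform g u) = φ u) → (∀ u, φ u ≠ 0 → u ∈ K.𝒰 β) →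
      tubeForm β (boFun L φ (K.Ω β)) ≤ K.σ β * K.γ β * (1 + K.κ β) * qform su2Rep ((L : ℝ) ^ 3 * β) φ φ +
        K.κ β * K.σ β * K.γ β * levelValue su2Rep 1 ((L : ℝ) ^ 3 * β) 0 * l2 φ φ :=
    fun φ h1 h2 h3 h4 => by have := (abs_le.mp (hT φ h1 h2 h3 h4)).2; linarith only [this]
  have hfs1 : ∀ U, f U ≠ 0 → χ β U ≠ 0 := fun U h => (hfs U h).1
  have hfsh : ∀ U, f U ≠ 0 → slowMean L U ∈ K.𝒰 β := fun U h => hshadow U (hfs U h).1 (hfs U h).2.1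
  have hfin : ∀ U, f U ≠ 0 → δc β / 2 < orbitDist U := fun U h => (hfs U h).2.2
  have hφin := boCoeff_inner_support (w := softWeight (χ β)) (𝒰 := K.𝒰 β) hfin hshadowIn
  have hδ₁2 : K.δ₁ β ≤ 2 := by linarith only [hδ₁]
  have hfix := shell_gain_fixed (K.hwm β) hCw (K.hw0 β) (K.hwinv β) (K.hΩm β) (K.hΩ1 β) (K.hΩinv β) (K.h𝒰m β) (K.h𝒰inv β) (K.h𝒰δ₁ β) hδ₁2
    (K.hσ β).le (K.hγ β) hκ0 hκhalf hN hTup hg0 hg1 hAG hμ0.le hθ0 hST hOD (fun φ U hφ hU => hbo φ U hφ hU) hfm hCf hfs1 hfsh hφin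
  set m : ℝ := min (g - 6 * K.κ β - 2 * K.b β ^ 2 / K.θ₀) (K.θ₀ / 2) with hmdef
  have hmA : A' * bareLambda ((L : ℝ) ^ 3 * β) ≤ m := by
    refine le_min ?_ hdom2
    rw [hgdef] at hdom1 ⊢; linarith only [hdom1]
  have hN0 : 0 ≤ tubeNormSq (softWeight (χ β)) f := integral_nonneg fun U => mul_nonneg (sq_nonneg _) (K.hw0 β U)
  have hSg0 : 0 ≤ K.σ β * levelValue su2Rep 1 ((L : ℝ) ^ 3 * β) 0 := mul_nonneg (K.hσ β).le hμ0.le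
  have h1 : 1 - m ≤ Real.exp (-(A' * bareLambda ((L : ℝ) ^ 3 * β))) := by
    have := Real.add_one_le_exp (-m)
    have h2 : Real.exp (-m) ≤ Real.exp (-(A' * bareLambda ((L : ℝ) ^ 3 * β))) := Real.exp_le_exp.mpr (by linarith only [hmA])
    linarith only [this, h2]
  have h3 : K.σ β * levelValue su2Rep 1 ((L : ℝ) ^ 3 * β) 0 ≤ Real.exp (bareLambda ((L : ℝ) ^ 3 * β)) * levelValue su2Rep L β 0 := by
    have e : Real.exp (bareLambda ((L : ℝ) ^ 3 * β)) * (Real.exp (-(bareLambda ((L : ℝ) ^ 3 * β))) * (K.σ β * levelValue su2Rep 1 ((L : ℝ) ^ 3 * β) 0)) =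
        K.σ β * levelValue su2Rep 1 ((L : ℝ) ^ 3 * β) 0 := by
      rw [← mul_assoc, ← Real.exp_add, add_neg_cancel, Real.exp_zero, one_mul]
    rw [← e]; exact mul_le_mul_of_nonneg_left hfloor (Real.exp_pos _).le
  have h4 : Real.exp (bareLambda ((L : ℝ) ^ 3 * β)) * Real.exp (-(A' * bareLambda ((L : ℝ) ^ 3 * β))) ≤ Real.exp (-(R β * bareLambda ((L : ℝ) ^ 3 * β))) := by
    rw [← Real.exp_add]; refine Real.exp_le_exp.mpr ?_
    have hA1 : R β * bareLambda ((L : ℝ) ^ 3 * β) ≤ |R β| * bareLambda ((L : ℝ) ^ 3 * β) := mul_le_mul_of_nonneg_right (le_abs_self _) hlam0.le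
    rw [hA']; nlinarith only [hA1, hlam0]
  calc tubeForm β f ≤ K.σ β * levelValue su2Rep 1 ((L : ℝ) ^ 3 * β) 0 * (1 - m) * tubeNormSq (softWeight (χ β)) f := hfix
    _ ≤ K.σ β * levelValue su2Rep 1 ((L : ℝ) ^ 3 * β) 0 * Real.exp (-(A' * bareLambda ((L : ℝ) ^ 3 * β))) * tubeNormSq (softWeight (χ β)) f :=
        mul_le_mul_of_nonneg_right (mul_le_mul_of_nonneg_left h1 hSg0) hN0
    _ ≤ Real.exp (bareLambda ((L : ℝ) ^ 3 * β)) * levelValue su2Rep L β 0 * Real.exp (-(A' * bareLambda ((L : ℝ) ^ 3 * β))) * tubeNormSq (softWeight (χ β)) f :=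
        mul_le_mul_of_nonneg_right (mul_le_mul_of_nonneg_right h3 (Real.exp_pos _).le) hN0
    _ = Real.exp (bareLambda ((L : ℝ) ^ 3 * β)) * Real.exp (-(A' * bareLambda ((L : ℝ) ^ 3 * β))) * levelValue su2Rep L β 0 * tubeNormSq (softWeight (χ β)) f := by ring
    _ ≤ Real.exp (-(R β * bareLambda ((L : ℝ) ^ 3 * β))) * levelValue su2Rep L β 0 * tubeNormSq (softWeight (χ β)) f :=
        mul_le_mul_of_nonneg_right (mul_le_mul_of_nonneg_right h4 hΛ0.le) hN0

/-! ## §3 The log rate -/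

/-- ★★★ **THE SUP BOUND ON THE SOFT TUBE WITH LOG RATE**: from `ShellBricks L χ δc δ` and the LOG-RATE domination `hdomLog` (the field `hdom` with `A ↦ c·log β`), for every `c`,
eventually in `β`, every bounded measurable `f` supported in `supp χ ∩ {orbitDist < δ} ∩ {δc/2 < orbitDist}` has `T(f) ≤ e^{−(c·log β)·λ_b(L³β)}·λ₀(β,L)·‖f‖²_{N/χ}`.
[cite: Luscher1983, §3] [cite: SjostrandZworski2007, §2] -/
theorem softTubeGainLog_of_shellBricks {χ : ℝ → GaugeConfig 3 L SU2 → ℝ} {δc δ : ℝ → ℝ} (K : ShellBricks L χ δc δ)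
    (hdomLog : ∀ c : ℝ, ∀ᶠ β : ℝ in atTop, c * Real.log β * bareLambda ((L : ℝ) ^ 3 * β) + 6 * K.κ β + 2 * K.b β ^ 2 / K.θ₀ ≤ K.t β * Real.sqrt (K.t β) / 80 ∧
      c * Real.log β * bareLambda ((L : ℝ) ^ 3 * β) ≤ K.θ₀ / 2) (c : ℝ) :
    ∃ β0 : ℝ, ∀ β : ℝ, β0 ≤ β → ∀ f : GaugeConfig 3 L SU2 → ℝ, Measurable f → (∃ C : ℝ, ∀ U, |f U| ≤ C) →
      (∀ U, f U ≠ 0 → χ β U ≠ 0 ∧ orbitDist U < δ β ∧ δc β / 2 < orbitDist U) →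
        tubeForm β f ≤ Real.exp (-(c * Real.log β * bareLambda ((L : ℝ) ^ 3 * β))) * levelValue su2Rep L β 0 * tubeNormSq (softWeight (χ β)) f := by
  have hL1 : (1 : ℝ) ≤ (L : ℝ) ^ 3 := one_le_pow₀ (by exact_mod_cast NeZero.one_le)
  have hdomR : ∀ᶠ β : ℝ in atTop, (|c * Real.log β| + 1) * bareLambda ((L : ℝ) ^ 3 * β) + 6 * K.κ β + 2 * K.b β ^ 2 / K.θ₀ ≤ K.t β * Real.sqrt (K.t β) / 80 ∧
      (|c * Real.log β| + 1) * bareLambda ((L : ℝ) ^ 3 * β) ≤ K.θ₀ / 2 := by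
    filter_upwards [hdomLog (|c| + 1), Filter.eventually_ge_atTop (Real.exp 1)] with β hβ hβe
    have hβ0 : 0 < β := lt_of_lt_of_le (Real.exp_pos 1) hβe
    have hlam0 : 0 < bareLambda ((L : ℝ) ^ 3 * β) := bareLambda_pos' (by nlinarith)
    have h := log_rate_abs_le (c := c) hβe hlam0.le
    exact ⟨by linarith [hβ.1], h.trans hβ.2⟩
  obtain ⟨β₀, hβ₀⟩ := Filter.eventually_atTop.mp (softTubeGainRate_of_shellBricks K (fun β => c * Real.log β) hdomR)
  exact ⟨β₀, fun β hβ => hβ₀ β hβ⟩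

/-- ★★★ **A THIN C4-SHELL WITH LOG RATE FROM ITS BRICKS**: `ShellBricks L χ δc δ → hdomLog → ShellGainOneOrbitLogAt L δc δ η` (every action scale `η`).  Slice reduction
(✓`qform_eq_integral_avgKernel`, ✓`l2_eq_sliceFn_left`) of ★★★ `softTubeGainLog_of_shellBricks`, as in ✓`shellGainOneOrbitAt_of_shellBricks`. [cite: Luscher1983, §3] [cite: SeilerLNP1982, §3] -/
theorem shellGainOneOrbitLogAt_of_shellBricks {χ : ℝ → GaugeConfig 3 L SU2 → ℝ} {δc δ : ℝ → ℝ} (K : ShellBricks L χ δc δ)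
    (hdomLog : ∀ c : ℝ, ∀ᶠ β : ℝ in atTop, c * Real.log β * bareLambda ((L : ℝ) ^ 3 * β) + 6 * K.κ β + 2 * K.b β ^ 2 / K.θ₀ ≤ K.t β * Real.sqrt (K.t β) / 80 ∧
      c * Real.log β * bareLambda ((L : ℝ) ^ 3 * β) ≤ K.θ₀ / 2) (η : ℝ → ℝ) :
    ShellGainOneOrbitLogAt L δc δ η := by
  obtain ⟨hχm, hχb, β1, hβ1⟩ := K.hadm
  intro c
  obtain ⟨β0, hβ0⟩ := softTubeGainLog_of_shellBricks K hdomLog c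
  refine ⟨max β0 β1, fun β hβ G hGm hGb hGinv hGsupp => ?_⟩
  have hβ0' : β0 ≤ β := (le_max_left _ _).trans hβ
  obtain ⟨hcov, n₀, hn₀, hNlow⟩ := hβ1 β ((le_max_right _ _).trans hβ)
  obtain ⟨Cχ, hCχ⟩ := hχb β
  obtain ⟨CG, hCG⟩ := hGb
  have hGcov : ∀ U, G U ≠ 0 → gaugeAvg (χ β) U ≠ 0 := fun U hU => (hcov U (hGsupp U hU).2.1).ne'
  set f : GaugeConfig 3 L SU2 → ℝ := Avg.sliceFn (χ β) G with hf_def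
  have h1 := qform_eq_integral_avgKernel β (hχm β) hCχ hn₀ hNlow hGm hCG hGinv hGcov hGm hCG hGinv hGcov
  have h2 := l2_eq_sliceFn_left (hχm β) hCχ hn₀ hNlow hGm hCG hGinv hGcov hGm hCG hGinv
  have hl2 : l2 G G = tubeNormSq (softWeight (χ β)) f := by
    rw [h2]
    unfold l2 tubeNormSq
    refine integral_congr_ae (ae_of_all _ fun U => ?_)
    exact sliceFn_mul_self_eq (ψ := G) hn₀ hNlow U
  have hq : qform su2Rep β G G = tubeForm β f := by rw [h1]; rfl
  have hfm : Measurable f := Avg.measurable_sliceFn (hχm β) hGm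
  have hfb : ∃ C : ℝ, ∀ U, |f U| ≤ C := ⟨CG * Cχ / n₀, Avg.abs_sliceFn_le hCχ hCG hn₀ hNlow⟩
  have hfs : ∀ U, f U ≠ 0 → χ β U ≠ 0 ∧ orbitDist U < δ β ∧ δc β / 2 < orbitDist U := fun U hU =>
    ⟨(Avg.sliceFn_ne_zero hU).1, (hGsupp U (Avg.sliceFn_ne_zero hU).2).2.1, (hGsupp U (Avg.sliceFn_ne_zero hU).2).2.2⟩
  rw [hq, hl2]
  exact hβ0 β hβ0' f hfm hfb hfs

end Summit.QuantumFields.YangMills.Theorems.FemtoTransferGap.TwoLattice.ConstTube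

/-! ## §4 The eight-copies step with log rate -/

namespace Summit.QuantumFields.YangMills.Theorems.FemtoTransferGap

variable {L : ℕ} [NeZero L]

/-- `7·cB ≤ e^{−((c·log β)+1)λ}·λ·Λ₀` eventually: the cross terms between the eight copies are negligible against a log-rate gain (`(c log β + 1)·λ_b(L³β) ≤ 2` eventually
by `log_mul_bareLambda_le_of_pos`, then ✓`crossBound_eventually_small` with `ε = 4e^{−2}` and the β-uniform floor). [folklore] -/
theorem crossBound_le_gain_log (c : ℝ) : ∃ β0 : ℝ, ∀ β : ℝ, β0 ≤ β →
    7 * crossBound L β (1 / (2 * L)) ≤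
      Real.exp (-((c * Real.log β + 1) * bareLambda ((L : ℝ) ^ 3 * β))) * bareLambda ((L : ℝ) ^ 3 * β) * levelValue su2Rep L β 0 := by
  have hL : (0 : ℝ) < L := by exact_mod_cast Nat.pos_of_ne_zero (NeZero.ne L)
  have hL1 : (1 : ℝ) ≤ (L : ℝ) ^ 3 := one_le_pow₀ (by exact_mod_cast NeZero.one_le)
  have hε : 0 < 4 * Real.exp (-2) := by positivity
  obtain ⟨βs, hs⟩ := crossBound_eventually_small (L := L) (m := 1 / (2 * L)) (by positivity) hε
  obtain ⟨βl, hl⟩ := Filter.eventually_atTop.mp (TwoLattice.ConstTube.log_mul_bareLambda_le_of_pos (L := L) |c| one_pos)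
  refine ⟨max (max 1 βs) (max βl (2 / (1 : ℝ) ^ 3)), fun β hβ => ?_⟩
  have hβ1 : 1 ≤ β := ((le_max_left _ _).trans (le_max_left _ _)).trans hβ
  have hβ0 : 0 < β := by linarith
  have hβs : βs ≤ β := ((le_max_right _ _).trans (le_max_left _ _)).trans hβ
  have hβl : βl ≤ β := ((le_max_left _ _).trans (le_max_right _ _)).trans hβ
  have hβτ : 2 / (1 : ℝ) ^ 3 ≤ β := ((le_max_right _ _).trans (le_max_right _ _)).trans hβ
  have hB'0 : 0 < (L : ℝ) ^ 3 * β := by nlinarith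
  have hlam0 : 0 < bareLambda ((L : ℝ) ^ 3 * β) := bareLambda_pos' hB'0
  have hlam1 : bareLambda ((L : ℝ) ^ 3 * β) ≤ 1 := bareLambda_cube_le (L := L) one_pos hβτ
  set lam := bareLambda ((L : ℝ) ^ 3 * β) with hlamdef
  have hΛ0 : 0 < levelValue su2Rep L β 0 := levelValue_su2Rep_pos hβ0 0
  have h1 : 28 * crossBound L β (1 / (2 * L)) ≤ 4 * Real.exp (-2) * lam * levelValue su2Rep L β 0 :=
    (hs β hβs).trans (mul_le_mul_of_nonneg_left (levelValue_zero_ge_uniform hβ1) (by positivity))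
  have hlog0 : 0 ≤ Real.log β := Real.log_nonneg hβ1
  have h2 : Real.exp (-2) ≤ Real.exp (-((c * Real.log β + 1) * lam)) := by
    refine Real.exp_le_exp.2 ?_
    have hc : c * Real.log β * lam ≤ |c| * Real.log β * lam :=
      mul_le_mul_of_nonneg_right (mul_le_mul_of_nonneg_right (le_abs_self c) hlog0) hlam0.le
    have hl' : |c| * Real.log β * lam ≤ 1 := hl β hβl
    nlinarith
  have h3 : 4 * Real.exp (-2) * lam * levelValue su2Rep L β 0 ≤ 4 * Real.exp (-((c * Real.log β + 1) * lam)) * lam * levelValue su2Rep L β 0 := by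
    have := mul_le_mul_of_nonneg_right (mul_le_mul_of_nonneg_right h2 hlam0.le) hΛ0.le
    linarith
  linarith [h1, h3]

/-- ★★ **C4-SHELL WITH LOG RATE from ONE orbit**: for positive outer radii that are eventually `≤ 1/(2L)`, `ShellGainOneOrbitLogAt L δc δ η → InnerShellGainSmallLogAt L δc δ η`.
A physical `φ` supported in the eight shells is the twist symmetrisation of its one-orbit cut (✓`twistSum_orbitCut`), `‖φ‖² = 8‖G‖²`, `⟨φ,Kφ⟩ ≤ 8⟨G,KG⟩ + 56·cB·‖G‖²`; the one-orbit gain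
at rate `c + 1` is below the rate `(c log β + 1)λ_b` once `log β ≥ 1`, and ✓`shell_copies_endgame` closes. [cite: Luscher1983, §3] [cite: SimonB1983DiscreteSpectrum, §3] -/
theorem innerShellGainSmallLogAt_of_oneOrbit {δc δ η : ℝ → ℝ} (hδ : ∀ β, 0 < δ β) (hδL : ∃ β1 : ℝ, ∀ β : ℝ, β1 ≤ β → δ β ≤ 1 / (2 * L))
    (h1 : ShellGainOneOrbitLogAt L δc δ η) : InnerShellGainSmallLogAt L δc δ η := by
  intro c
  have hL : (0 : ℝ) < L := by exact_mod_cast Nat.pos_of_ne_zero (NeZero.ne L)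
  have hL1 : (1 : ℝ) ≤ (L : ℝ) ^ 3 := one_le_pow₀ (by exact_mod_cast NeZero.one_le)
  obtain ⟨βI, hI⟩ := h1 (c + 1)
  obtain ⟨β1, hδ1⟩ := hδL
  obtain ⟨βc, hc⟩ := crossBound_le_gain_log (L := L) c
  refine ⟨max (max (Real.exp 1) βI) (max β1 βc), fun β hβ φ hφ hsupp => ?_⟩
  have hβe : Real.exp 1 ≤ β := ((le_max_left _ _).trans (le_max_left _ _)).trans hβ
  have hβ1 : 1 ≤ β := le_trans (by have := Real.add_one_le_exp (1 : ℝ); linarith) hβe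
  have hβ0 : 0 < β := by linarith
  have hβI : βI ≤ β := ((le_max_right _ _).trans (le_max_left _ _)).trans hβ
  have hβd : β1 ≤ β := ((le_max_left _ _).trans (le_max_right _ _)).trans hβ
  have hβc : βc ≤ β := ((le_max_right _ _).trans (le_max_right _ _)).trans hβ
  have hΛ0 : 0 < levelValue su2Rep L β 0 := levelValue_su2Rep_pos hβ0 0
  have hlam0 : 0 < bareLambda ((L : ℝ) ^ 3 * β) := bareLambda_pos' (by nlinarith)
  have hlog1 : 1 ≤ Real.log β := by
    have := Real.log_le_log (Real.exp_pos 1) hβe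
    rwa [Real.log_exp] at this
  have hδ0 := hδ β
  have hδ2 : δ β ≤ 1 / (2 * L) := hδ1 β hβd
  have hLδ : (L : ℝ) * δ β < 2 := by
    have := mul_le_mul_of_nonneg_left hδ2 hL.le
    have e : (L : ℝ) * (1 / (2 * L)) = 1 / 2 := by field_simp
    linarith
  have hLm : (L : ℝ) * (δ β + 1 / (2 * L)) < 2 := by
    have := mul_le_mul_of_nonneg_left hδ2 hL.le
    have e : (L : ℝ) * (1 / (2 * L)) = 1 / 2 := by field_simp
    nlinarith
  obtain ⟨C, hC⟩ := hφ.bounded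
  set G : GaugeConfig 3 L SU2 → ℝ := orbitCut (δ β) φ with hGdef
  have hGm : Measurable G := measurable_orbitCut _ hφ.measurable
  have hGb' : ∀ U, |G U| ≤ C := fun U => abs_orbitCut_le _ hC U
  have hGb : ∃ C' : ℝ, ∀ U, |G U| ≤ C' := ⟨C, hGb'⟩
  have hGg : ∀ (g : Site 3 L → SU2) (U : GaugeConfig 3 L SU2), G (gaugeTransform g U) = G U := fun g U =>
    orbitCut_gaugeTransform _ hφ.gaugeInv g U
  have hGs : ∀ U, G U ≠ 0 → orbitDist U < δ β := fun U h => orbitDist_lt_of_orbitCut_ne_zero h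
  have hGsupp : ∀ U, G U ≠ 0 → wilsonAction su2Rep U < 2 * η β ∧ orbitDist U < δ β ∧ δc β / 2 < orbitDist U := fun U h => by
    have hφU := hsupp U (ne_zero_of_orbitCut_ne_zero h)
    refine ⟨hφU.1, hGs U h, ?_⟩
    have := hφU.2.2 (fun _ => false)
    rwa [TT.twist3_false] at this
  have hsupp' : ∀ U, φ U ≠ 0 → ∃ z : Fin 3 → Bool, orbitDist (TT.twist3 z U) < δ β := fun U h => (hsupp U h).2.1
  have hcomb : φ = twistSum G := (twistSum_orbitCut hLδ hφ hsupp').symm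
  have hl2 : l2 φ φ = 8 * l2 G G := by rw [hcomb]; exact l2_twistSum hGm hGb' hLδ hGs
  have hq : qform su2Rep β φ φ ≤ 8 * qform su2Rep β G G + 56 * (crossBound L β (1 / (2 * L)) * l2 G G) := by
    rw [hcomb]
    have h := abs_qform_twistSum_sub_le hβ0.le hGm hGb' (by positivity : (0 : ℝ) ≤ 1 / (2 * L)) hLm hGs
    rw [abs_le] at h
    linarith [h.2]
  have hIG := hI β hβI G hGm hGb hGg hGsupp
  have hIG' : qform su2Rep β G G ≤ Real.exp (-((c * Real.log β + 1) * bareLambda ((L : ℝ) ^ 3 * β))) * levelValue su2Rep L β 0 * l2 G G := by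
    refine hIG.trans (mul_le_mul_of_nonneg_right (mul_le_mul_of_nonneg_right (Real.exp_le_exp.2 ?_) hΛ0.le) (l2_self_nonneg_lat _))
    have : (c * Real.log β + 1) * bareLambda ((L : ℝ) ^ 3 * β) ≤ (c + 1) * Real.log β * bareLambda ((L : ℝ) ^ 3 * β) := by
      have e : (c + 1) * Real.log β * bareLambda ((L : ℝ) ^ 3 * β) = (c * Real.log β + Real.log β) * bareLambda ((L : ℝ) ^ 3 * β) := by ring
      rw [e]; exact mul_le_mul_of_nonneg_right (by linarith) hlam0.le
    linarith
  rw [hl2]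
  exact shell_copies_endgame (l2_self_nonneg_lat _) hΛ0.le hq hIG' (hc β hβc)

/-- ★★ **Polynomial radii**: `ShellGainOneOrbitLogAt L (β^{−a}) (β^{−b}) (β^{−q}) → InnerShellGainSmallLogAt L (β^{−a}) (β^{−b}) (β^{−q})` for every outer exponent `0 < b`.
[cite: Luscher1983, §3] -/
theorem innerShellGainSmallLogAt_pow_of_oneOrbit {a b q : ℝ} (hb : 0 < b)
    (h1 : ShellGainOneOrbitLogAt L (powScale a) (powScale b) (powScale q)) :
    InnerShellGainSmallLogAt L (powScale a) (powScale b) (powScale q) := by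
  have hL : (0 : ℝ) < L := by exact_mod_cast Nat.pos_of_ne_zero (NeZero.ne L)
  exact innerShellGainSmallLogAt_of_oneOrbit (fun β => powScale_pos b β) (powScale_eventually_le hb (by positivity)) h1

end Summit.QuantumFields.YangMills.Theorems.FemtoTransferGap

/-! ## §5 The thin shell with log rate from its bricks -/

namespace Summit.QuantumFields.YangMills.Theorems.FemtoTransferGap.TwoLattice.ConstTube

open Summit.QuantumFields.YangMills.Theorems.FemtoTransferGap

variable {L : ℕ} [NeZero L]

/-- ★★★ **Polynomial radii, log rate**: `ShellBricks L χ (β^{−a}) (β^{−b})` (`0 < b`) with the log-rate domination gives the thin shell WITH LOG RATE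
`InnerShellGainSmallLogAt L (β^{−a}) (β^{−b}) (β^{−q})` for every `q`. [cite: Luscher1983, §3] -/
theorem innerShellGainSmallLogAt_of_shellBricks {χ : ℝ → GaugeConfig 3 L SU2 → ℝ} {a b q : ℝ} (hb : 0 < b) (K : ShellBricks L χ (powScale a) (powScale b))
    (hdomLog : ∀ c : ℝ, ∀ᶠ β : ℝ in atTop, c * Real.log β * bareLambda ((L : ℝ) ^ 3 * β) + 6 * K.κ β + 2 * K.b β ^ 2 / K.θ₀ ≤ K.t β * Real.sqrt (K.t β) / 80 ∧
      c * Real.log β * bareLambda ((L : ℝ) ^ 3 * β) ≤ K.θ₀ / 2) :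
    InnerShellGainSmallLogAt L (powScale a) (powScale b) (powScale q) :=
  innerShellGainSmallLogAt_pow_of_oneOrbit hb (shellGainOneOrbitLogAt_of_shellBricks K hdomLog (powScale q))

end Summit.QuantumFields.YangMills.Theorems.FemtoTransferGap.TwoLattice.ConstTube

end
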